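import Mathlib

/-!
# `Balaban1983to89.B4Eq19CampanatoIteration` — T. Bałaban, *Propagators and renormalization transformations for lattice gauge theories. II*,
# Commun. Math. Phys. **96** (1984) 223–250 [Balaban1984PropagatorsII] (1.9) p. 226: **CAMPANATO'S ITERATION LEMMA** ([Giaquinta1984] Ch. III Lemma 2.1
# p. 86) in the integer-exponent form used on the lattice: a nonnegative nondecreasing `ψ` on `[1, R₀]` with
# `ψ(P) ≤ A (P∕R)^d ψ(R) + B R^d` (`1 ≤ P ≤ R ≤ R₀`) satisfies `ψ(P) ≤ 2(2A)^{2(d−1)} (P∕R)^{d−1} (ψ(R) + B R^d)` — the exponent drops from `d` to `d − 1`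
# (Hölder exponent `½` downstream) and the inhomogeneity is carried along; the real-variable engine of the Campanato road to the LOCAL η-scale Hölder estimate
# `Hloc` of `B9Eq343FlatWindowLetterOfLocalHolder`.

statement-level skeleton of published theorems with citation tags; proofs where landed; nothing here is a claim about the Yang–Mills mass gap

CITATION HEADER (lean-in-tree rule).  Audit cell `pub-balaban`, sub-cell `t4`, BINDER row NE9; filed by NE9 crux-team LEAF PROVER 01
(`b2b-balaban-t4-ne9-formalise-leaf-01`, gen 94; bears_on: R4/N22).  CONTENT: [Giaquinta1984] Ch. III Lemma 2.1 p. 86 (with `ε = 0`, `α = d`, `β`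
replaced by the inhomogeneity exponent `d` and output exponent `d − 1`, `τ = 1∕(2A)`), proof as printed (geometric iteration along `τ^k R`, then monotonicity
between two consecutive radii).  Nothing of [Balaban1984PropagatorsII] is asserted.

WHAT IS PROVED (sorry-free; proof lane — 0 `def`).
* `iterate_step` — along `R_k = τ^k R`, `τ = 1∕(2A)`: `ψ(τ^k R) ≤ τ^{k(d−1)} (ψ(R) + 2B R^d (2A)^{d−1})` while `τ^k R ≥ 1`.
* **`campanato_iteration`** — THE LEMMA: `ψ(P) ≤ 2(2A)^{2(d−1)} (P∕R)^{d−1} (ψ(R) + B R^d)` for `1 ≤ P ≤ R ≤ R₀` (`d ≥ 1`, `A ≥ 1`, `B ≥ 0`).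
HONEST SCOPE.  A printed real-variable lemma, proved; NOT summit progress (cell pub-balaban: NE9 NOT PRINTED ∕ NOT PROVED; spine PROVED 0∕9; finite T⁴ —
NOT infinite volume, NOT mass gap, NOT BetaPertH, NOT Clay).  NEW file importing Mathlib only.  Net new unproved facts: 0.
-/

noncomputable section

namespace Literature.MathematicalPhysics.QuantumFieldTheory.Balaban1983to89.B4Eq19CampanatoIteration

/-- **The geometric iteration along `R_k = τ^k R`, `τ = 1∕(2A)`**: if `ψ ≥ 0` on `[1,R₀]` and `ψ(P) ≤ A(P∕R')^dψ(R') + B R'^d` for `1 ≤ P ≤ R' ≤ R₀`,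
then for every `k` with `τ^k R ≥ 1` (`1 ≤ R ≤ R₀`): `ψ(τ^k R) ≤ τ^{k(d−1)}·(ψ(R) + 2 B R^d (2A)^{d−1})`.
[cite: Giaquinta1984, Ch. III Lemma 2.1 p.86] -/
theorem iterate_step {ψ : ℝ → ℝ} {A B R₀ : ℝ} {d : ℕ} (hd : 1 ≤ d) (hA : 1 ≤ A) (hB : 0 ≤ B)
    (hψ0 : ∀ t, 1 ≤ t → t ≤ R₀ → 0 ≤ ψ t)
    (hyp : ∀ P R, 1 ≤ P → P ≤ R → R ≤ R₀ → ψ P ≤ A * (P / R) ^ d * ψ R + B * R ^ d)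
    {R : ℝ} (hR1 : 1 ≤ R) (hR : R ≤ R₀) :
    ∀ k : ℕ, 1 ≤ (1 / (2 * A)) ^ k * R →
      ψ ((1 / (2 * A)) ^ k * R) ≤ ((1 / (2 * A)) ^ k) ^ (d - 1) * (ψ R + 2 * B * R ^ d * (2 * A) ^ (d - 1)) := by
  set τ : ℝ := 1 / (2 * A) with hτ
  have hA0 : 0 < A := by linarith
  have hτ0 : 0 < τ := by rw [hτ]; positivity
  have hτ1 : τ ≤ 1 := by rw [hτ, div_le_one (by positivity)]; linarith
  have hτA : τ * (2 * A) = 1 := by rw [hτ]; field_simp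
  have hτinv : (2 * A) ^ (d - 1) * τ ^ (d - 1) = 1 := by rw [← mul_pow, mul_comm, hτA, one_pow]
  have hR0 : 0 < R := by linarith
  set M : ℝ := ψ R + 2 * B * R ^ d * (2 * A) ^ (d - 1) with hM
  have hψR : 0 ≤ ψ R := hψ0 R hR1 hR
  intro k
  induction k with
  | zero =>
    intro _
    simp only [pow_zero, one_mul, one_pow]
    rw [hM]
    have : 0 ≤ 2 * B * R ^ d * (2 * A) ^ (d - 1) := by positivity
    linarith
  | succ k ih =>
    intro hk1
    -- `τ^{k+1} R ≥ 1` forces `τ^k R ≥ 1` (`τ ≤ 1`)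
    have hk0 : 1 ≤ τ ^ k * R := by
      have : τ ^ (k + 1) * R ≤ τ ^ k * R := by
        rw [pow_succ]
        have : τ ^ k * τ ≤ τ ^ k * 1 := mul_le_mul_of_nonneg_left hτ1 (by positivity)
        nlinarith
      linarith
    have hkR : τ ^ k * R ≤ R := by
      have : τ ^ k ≤ 1 := pow_le_one₀ hτ0.le hτ1
      nlinarith
    have ihk := ih hk0
    -- one step of the hypothesis between `τ^{k+1}R` and `τ^k R`
    have hstep := hyp (τ ^ (k + 1) * R) (τ ^ k * R) hk1 (by
      rw [pow_succ]; have : τ ^ k * τ ≤ τ ^ k * 1 := mul_le_mul_of_nonneg_left hτ1 (by positivity); nlinarith) (hkR.trans hR)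
    have hratio : τ ^ (k + 1) * R / (τ ^ k * R) = τ := by
      rw [pow_succ]; field_simp
    rw [hratio] at hstep
    -- `A τ^d = τ^{d-1}/2`
    have hAτ : A * τ ^ d = τ ^ (d - 1) / 2 := by
      have : τ ^ d = τ ^ (d - 1) * τ := by rw [← pow_succ]; congr 1; omega
      rw [this, hτ]; field_simp
    have hψk0 : 0 ≤ ψ (τ ^ k * R) := hψ0 _ hk0 (hkR.trans hR)
    -- the inhomogeneity: `B (τ^k R)^d ≤ τ^{k(d-1)} B R^d τ^k ≤ …`
    have hpow : (τ ^ k * R) ^ d = (τ ^ k) ^ (d - 1) * τ ^ k * R ^ d := by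
      have : (τ ^ k * R) ^ d = (τ ^ k) ^ d * R ^ d := mul_pow _ _ _
      rw [this, show (τ ^ k) ^ d = (τ ^ k) ^ (d - 1) * τ ^ k by rw [← pow_succ]; congr 1; omega]
    have hτk1 : τ ^ k ≤ 1 := pow_le_one₀ hτ0.le hτ1
    have hkey : B * (τ ^ k * R) ^ d ≤ (τ ^ k) ^ (d - 1) * τ ^ (d - 1) * (B * R ^ d * (2 * A) ^ (d - 1)) := by
      rw [hpow]
      have e : (τ ^ k) ^ (d - 1) * τ ^ (d - 1) * (B * R ^ d * (2 * A) ^ (d - 1)) =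
          (τ ^ k) ^ (d - 1) * (B * R ^ d) * ((2 * A) ^ (d - 1) * τ ^ (d - 1)) := by ring
      rw [e, hτinv, mul_one]
      have h1 : B * ((τ ^ k) ^ (d - 1) * τ ^ k * R ^ d) = (τ ^ k) ^ (d - 1) * (B * R ^ d) * τ ^ k := by ring
      rw [h1]
      have h2 : 0 ≤ (τ ^ k) ^ (d - 1) * (B * R ^ d) := by positivity
      nlinarith
    -- assemble
    have htarget : (τ ^ (k + 1)) ^ (d - 1) * M = (τ ^ k) ^ (d - 1) * τ ^ (d - 1) * M := by
      rw [pow_succ, mul_pow]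
    rw [htarget]
    calc ψ (τ ^ (k + 1) * R) ≤ A * τ ^ d * ψ (τ ^ k * R) + B * (τ ^ k * R) ^ d := hstep
      _ = τ ^ (d - 1) / 2 * ψ (τ ^ k * R) + B * (τ ^ k * R) ^ d := by rw [hAτ]
      _ ≤ τ ^ (d - 1) / 2 * ((τ ^ k) ^ (d - 1) * M) + (τ ^ k) ^ (d - 1) * τ ^ (d - 1) * (B * R ^ d * (2 * A) ^ (d - 1)) := by
          have := mul_le_mul_of_nonneg_left ihk (by positivity : (0:ℝ) ≤ τ ^ (d - 1) / 2)
          linarith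
      _ = (τ ^ k) ^ (d - 1) * τ ^ (d - 1) * (M / 2 + B * R ^ d * (2 * A) ^ (d - 1)) := by ring
      _ ≤ (τ ^ k) ^ (d - 1) * τ ^ (d - 1) * M := by
          apply mul_le_mul_of_nonneg_left _ (by positivity)
          rw [hM]; linarith

/-- **CAMPANATO'S ITERATION LEMMA** ([Giaquinta1984] Ch. III Lemma 2.1), lattice form.  Let `d ≥ 1`, `A ≥ 1`, `B ≥ 0`, and let `ψ` be nonnegative and
nondecreasing on `[1, R₀]` with `ψ(P) ≤ A (P∕R)^d ψ(R) + B R^d` whenever `1 ≤ P ≤ R ≤ R₀`.  Then for all `1 ≤ P ≤ R ≤ R₀`: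
`ψ(P) ≤ 2 (2A)^{2(d−1)} (P∕R)^{d−1} (ψ(R) + B R^d)` (choose `τ = 1∕(2A)`, iterate along `τ^k R` by `iterate_step`, and compare `P` with the nearest
`τ^k R ≥ P` by monotonicity). [cite: Giaquinta1984, Ch. III Lemma 2.1 p.86; Balaban1984PropagatorsII, (1.9) p.226] -/
theorem campanato_iteration {ψ : ℝ → ℝ} {A B R₀ : ℝ} {d : ℕ} (hd : 1 ≤ d) (hA : 1 ≤ A) (hB : 0 ≤ B)
    (hψ0 : ∀ t, 1 ≤ t → t ≤ R₀ → 0 ≤ ψ t)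
    (hmono : ∀ s t, 1 ≤ s → s ≤ t → t ≤ R₀ → ψ s ≤ ψ t)
    (hyp : ∀ P R, 1 ≤ P → P ≤ R → R ≤ R₀ → ψ P ≤ A * (P / R) ^ d * ψ R + B * R ^ d) :
    ∀ P R, 1 ≤ P → P ≤ R → R ≤ R₀ → ψ P ≤ 2 * (2 * A) ^ (2 * (d - 1)) * (P / R) ^ (d - 1) * (ψ R + B * R ^ d) := by
  intro P R hP hPR hR
  set τ : ℝ := 1 / (2 * A) with hτ
  have hA0 : 0 < A := by linarith
  have hτ0 : 0 < τ := by rw [hτ]; positivity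
  have hτ1 : τ < 1 := by rw [hτ, div_lt_one (by positivity)]; linarith
  have hτA : τ * (2 * A) = 1 := by rw [hτ]; field_simp
  have hR1 : 1 ≤ R := hP.trans hPR
  have hR0 : 0 < R := by linarith
  have hψR : 0 ≤ ψ R := hψ0 R hR1 hR
  -- the least `k` with `τ^{k+1} R < P`
  have hex : ∃ k : ℕ, τ ^ (k + 1) * R < P := by
    obtain ⟨n, hn⟩ := exists_pow_lt_of_lt_one (show 0 < P / R by positivity) hτ1
    refine ⟨n, ?_⟩
    rw [lt_div_iff₀ hR0] at hn
    calc τ ^ (n + 1) * R = τ ^ n * R * τ := by rw [pow_succ]; ring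
      _ ≤ τ ^ n * R * 1 := mul_le_mul_of_nonneg_left hτ1.le (by positivity)
      _ = τ ^ n * R := mul_one _
      _ < P := hn
  classical
  let k := Nat.find hex
  have hk : τ ^ (k + 1) * R < P := Nat.find_spec hex
  have hkP : P ≤ τ ^ k * R := by
    by_cases hk0 : k = 0
    · rw [hk0, pow_zero, one_mul]; exact hPR
    · obtain ⟨j, hj⟩ := Nat.exists_eq_succ_of_ne_zero hk0
      have hmin := Nat.find_min hex (show j < k by omega)
      push Not at hmin
      rw [hj]; exact hmin
  have hk1 : 1 ≤ τ ^ k * R := hP.trans hkP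
  have hkR : τ ^ k * R ≤ R := by
    have : τ ^ k ≤ 1 := pow_le_one₀ hτ0.le hτ1.le
    nlinarith
  -- iterate
  have hiter := iterate_step hd hA hB hψ0 hyp hR1 hR k hk1
  -- monotonicity between `P` and `τ^k R`
  have h1 : ψ P ≤ ψ (τ ^ k * R) := hmono P _ hP hkP (hkR.trans hR)
  -- `τ^k ≤ (P/R)/τ`, so `τ^{k(d-1)} ≤ (P/R)^{d-1} (2A)^{d-1}`
  have hτk : τ ^ k ≤ P / R * (2 * A) := by
    have h2 : τ ^ k * τ * R < P := by rw [← pow_succ]; exact hk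
    have h3 : τ ^ k * R < P * (2 * A) := by
      have := mul_lt_mul_of_pos_right h2 (show (0:ℝ) < 2 * A by positivity)
      calc τ ^ k * R = τ ^ k * R * (τ * (2 * A)) := by rw [hτA, mul_one]
        _ = τ ^ k * τ * R * (2 * A) := by ring
        _ < P * (2 * A) := this
    rw [div_mul_eq_mul_div, le_div_iff₀ hR0]
    exact h3.le
  have hτkd : (τ ^ k) ^ (d - 1) ≤ (P / R) ^ (d - 1) * (2 * A) ^ (d - 1) := by
    rw [← mul_pow]; exact pow_le_pow_left₀ (by positivity) hτk _
  have hM : ψ R + 2 * B * R ^ d * (2 * A) ^ (d - 1) ≤ 2 * (2 * A) ^ (d - 1) * (ψ R + B * R ^ d) := by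
    have h2A : (1 : ℝ) ≤ (2 * A) ^ (d - 1) := one_le_pow₀ (by linarith)
    have : ψ R ≤ 2 * (2 * A) ^ (d - 1) * ψ R := by nlinarith
    nlinarith [mul_nonneg hB (pow_nonneg hR0.le d)]
  have hMnn : 0 ≤ ψ R + 2 * B * R ^ d * (2 * A) ^ (d - 1) := by positivity
  calc ψ P ≤ ψ (τ ^ k * R) := h1
    _ ≤ (τ ^ k) ^ (d - 1) * (ψ R + 2 * B * R ^ d * (2 * A) ^ (d - 1)) := hiter
    _ ≤ ((P / R) ^ (d - 1) * (2 * A) ^ (d - 1)) * (2 * (2 * A) ^ (d - 1) * (ψ R + B * R ^ d)) :=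
        mul_le_mul hτkd hM hMnn (by positivity)
    _ = 2 * (2 * A) ^ (2 * (d - 1)) * (P / R) ^ (d - 1) * (ψ R + B * R ^ d) := by rw [two_mul (d - 1), pow_add]; ring

end Literature.MathematicalPhysics.QuantumFieldTheory.Balaban1983to89.B4Eq19CampanatoIteration

end
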